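import Literature.Probability.LatticeModels.FourFunctionsAE
import Summits.CriticalPhenomena.PercolationContinuityZ3.Theorems.SahiCMTP2DensityConverse
import Mathlib.Order.Filter.Ultrafilter.Basic

/-!
# An everywhere-MTP₂ version of a bounded density that is MTP₂ on almost every pair

Support file of the Sahi cell (`prim-sahi`, typer seat, generation 20; `--supports stmt-CriticalPhenomena-4575`).
Theorems only (no definitions, no named facts, no sorries).

The "everywhere-version residue" recorded as open in generations 18–19 (the regularisation step behind
[MullerStoyan2002] Thm. 3.10.14 and the everywhere form of [FuchsWang2026] (5.1) ⟹ (1.2)): given a measurable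
`f : ℝ^ι → [0,∞]` which is MTP₂ on `π ⊗ π`-ALMOST EVERY pair, `π = ⊗ᵢ ρᵢ` a product reference measure, is there a
VERSION of `f` (equal `π`-a.e.) that is MTP₂ at EVERY pair?

* `exists_mtp2_version_of_ae` (finite factors), `exists_mtp2_version_of_ae_of_isLocallyFiniteMeasure` (locally finite
  factors), `exists_mtp2_version_of_ae_volume` (Lebesgue on `ℝ^ι`) — **YES for bounded `f`, up to measurability of the
  version**: there is `g : ℝ^ι → [0,∞]` with `g = f` `π`-a.e. (so `g` is `π`-a.e.-measurable and `π·g = π·f`),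
  `g ≤ M`, and `g(x) g(y) ≤ g(x ∧ y) g(x ∨ y)` for ALL `x, y`.

Construction.  By the almost-everywhere four functions theorem (generation 19, [BattyBollmann1980] Thm. 3.7;
tree `Literature.Probability.LatticeModels.Affiliation.mIsSetTP2_withDensity_pi_of_ae`, [BattyBollmann1980] Thm. 3.7 in
`FourFunctionsAE.lean`) the law `ν = f·π` is set-TP₂, so on sup-norm balls (closed boxes)
`ν(B(x,r)) ν(B(y,r)) ≤ ν(B(x∧y,r)) ν(B(x∨y,r))` for ALL `x, y, r`; dividing by the product identity
`π(B(x,r)) π(B(y,r)) = π(B(x∧y,r)) π(B(x∨y,r))` (`SahiCMTP2.pi_closedBall_mul_eq`) the RATIOS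
`R_r(x) = ν(B(x,r))/π(B(x,r))` are MTP₂ at every pair for every `r`.  Now let `r_n = 1/(n+1)` and define
`g(x) := lim_𝔘 R_{r_n}(x)` along a fixed non-principal ultrafilter `𝔘` on `ℕ` (Mathlib's `hyperfilter ℕ`): the
limit exists everywhere in the compact space `[0,∞]`, is bounded by `M`, is MULTIPLICATIVE and monotone on bounded
sequences — so the ratio inequalities pass to `g` at EVERY pair — and agrees with the ordinary limit where that exists,
which by Besicovitch–Lebesgue differentiation (`Besicovitch.ae_tendsto_rnDeriv`) is `f(x)` for `π`-a.e. `x`.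

What is NOT claimed: that `g` is Borel measurable (an ultrafilter limit need not be); only `g = f` a.e., hence
`AEMeasurable g π`.  The naive Borel candidate `x ↦ limsup_r R_r(x)` can fail to be MTP₂ (sketch: `f(s,t) = φ(s)ψ(t)`
on `ℝ²`, `φ = e^{h}`, `ψ = e^{-h}` with `h(s) = (log 2) sin(log log (1/|s|))` near `0` and `φ = ψ = 1` near `1`: `f` is
MTP₂ with equality and the ball averages track the values, so `limsup R(0,1) · limsup R(1,0) = 2 · 2` while
`limsup R(1,1) · limsup R(0,0) = 1 · 1`), and `liminf` fails dually; a multiplicative monotone extension of `lim` to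
bounded sequences is exactly an ultrafilter limit.  Whether a BOREL everywhere-MTP₂ version always exists is left
open here.

No sorries, no new axioms (the ultrafilter comes from `Classical.choice`, already in the standard axiom set).
-/

noncomputable section

namespace Summit.CriticalPhenomena.PercolationContinuityZ3.Theorems.SahiAEFourFunctions

open MeasureTheory Set Filter Topology Metric
open Literature.Probability.LatticeModels Literature.Probability.LatticeModels.Affiliation
open Summit.CriticalPhenomena.PercolationContinuityZ3.Theorems.SahiCMTP2
open scoped ENNReal

variable {ι : Type*} [Fintype ι]

/-- Set-TP₂ on sup-norm balls: `ν(B(u,r)) ν(B(v,r)) ≤ ν(B(u ∧ v,r)) ν(B(u ∨ v,r))`. [folklore] -/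
private theorem closedBall_mul_le_of_mIsSetTP2 {ν : Measure (ι → ℝ)} (h : mIsSetTP2 ν) (u v : ι → ℝ) {r : ℝ}
    (hr : 0 ≤ r) :
    ν (closedBall u r) * ν (closedBall v r) ≤ ν (closedBall (u ⊓ v) r) * ν (closedBall (u ⊔ v) r) := by
  simp only [closedBall_eq_Icc_pi _ hr]
  have h1 := h.icc (fun i => u i - r) (fun i => u i + r) (fun i => v i - r) (fun i => v i + r)
  have e1 : ((fun i => u i - r) ⊓ fun i => v i - r) = fun i => (u ⊓ v) i - r :=
    funext fun i => min_sub_sub_right _ _ _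
  have e2 : ((fun i => u i + r) ⊓ fun i => v i + r) = fun i => (u ⊓ v) i + r :=
    funext fun i => min_add_add_right _ _ _
  have e3 : ((fun i => u i - r) ⊔ fun i => v i - r) = fun i => (u ⊔ v) i - r :=
    funext fun i => max_sub_sub_right _ _ _
  have e4 : ((fun i => u i + r) ⊔ fun i => v i + r) = fun i => (u ⊔ v) i + r :=
    funext fun i => max_add_add_right _ _ _
  rwa [e1, e2, e3, e4] at h1

/-- An ultrafilter limit in `[0,∞]` exists for every sequence (compactness). [folklore] -/
private theorem exists_tendsto_hyperfilter (s : ℕ → ℝ≥0∞) :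
    ∃ l : ℝ≥0∞, Tendsto s (hyperfilter ℕ : Filter ℕ) (𝓝 l) := by
  obtain ⟨l, -, hl⟩ := isCompact_univ.ultrafilter_le_nhds' ((hyperfilter ℕ).map s) univ_mem
  exact ⟨l, hl⟩

/-- **An everywhere-MTP₂ version of a bounded almost-everywhere-pair MTP₂ density.**  Let `π = ⊗ᵢ ρᵢ` be a product of
finite measures on `ℝ^ι` (`ι` finite) and `f : ℝ^ι → [0,∞]` measurable, bounded by `M < ∞`, with
`f(x) f(y) ≤ f(x ∧ y) f(x ∨ y)` for `π ⊗ π`-ALMOST EVERY `(x, y)`.  Then there is `g : ℝ^ι → [0,∞]`, `g ≤ M`,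
`g = f` `π`-almost everywhere, with `g(x) g(y) ≤ g(x ∧ y) g(x ∨ y)` for ALL `x, y`.  (`g` = ultrafilter limit of the
ratios `(f·π)(B(x,r_n))/π(B(x,r_n))` over shrinking sup-norm balls; MTP₂ of the ratios at every pair from the a.e.
four functions theorem and the product identity for `π` on boxes; `g = f` a.e. by Besicovitch differentiation.
Measurability of `g` is not asserted beyond `g =ᵐ[π] f`.) [this work] -/
theorem exists_mtp2_version_of_ae (ρ : ι → Measure ℝ) [∀ i, IsFiniteMeasure (ρ i)] (f : (ι → ℝ) → ℝ≥0∞)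
    (hf : Measurable f) {M : ℝ≥0∞} (hM : M ≠ ∞) (hfM : ∀ x, f x ≤ M)
    (hMTP : ∀ᵐ p ∂(Measure.pi ρ).prod (Measure.pi ρ), f p.1 * f p.2 ≤ f (p.1 ⊓ p.2) * f (p.1 ⊔ p.2)) :
    ∃ g : (ι → ℝ) → ℝ≥0∞, (∀ x, g x ≤ M) ∧ g =ᵐ[Measure.pi ρ] f ∧
      ∀ x y, g x * g y ≤ g (x ⊓ y) * g (x ⊔ y) := by
  set π := Measure.pi ρ with hπ
  set ν := π.withDensity f with hν
  -- `ν` is finite (`f ≤ M`, `π` finite)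
  have hνfin : ν univ ≠ ∞ := by
    rw [hν, withDensity_apply _ MeasurableSet.univ, Measure.restrict_univ]
    refine ne_top_of_le_ne_top (ENNReal.mul_ne_top hM (measure_ne_top π univ)) ?_
    calc ∫⁻ x, f x ∂π ≤ ∫⁻ _, M ∂π := lintegral_mono hfM
      _ = M * π univ := lintegral_const M
  haveI : IsFiniteMeasure ν := ⟨hνfin.lt_top⟩
  -- set-TP₂ of `ν` from the a.e. four functions theorem, on balls
  have hTP : mIsSetTP2 ν :=
    Literature.Probability.LatticeModels.Affiliation.mIsSetTP2_withDensity_pi_of_ae ρ f hf hMTP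
  -- the ratios
  set R : ℕ → (ι → ℝ) → ℝ≥0∞ := fun n x =>
    ν (closedBall x ((n : ℝ) + 1)⁻¹) / π (closedBall x ((n : ℝ) + 1)⁻¹) with hR
  have hrpos : ∀ n : ℕ, (0 : ℝ) < ((n : ℝ) + 1)⁻¹ := fun n => by positivity
  have hνle : ∀ (x : ι → ℝ) (r : ℝ), ν (closedBall x r) ≤ M * π (closedBall x r) := fun x r => by
    rw [hν, withDensity_apply _ measurableSet_closedBall]
    calc ∫⁻ y in closedBall x r, f y ∂π ≤ ∫⁻ _ in closedBall x r, M ∂π := lintegral_mono hfM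
      _ = M * π (closedBall x r) := by rw [setLIntegral_const]
  have hRle : ∀ n x, R n x ≤ M := fun n x => by
    simp only [hR]
    exact ENNReal.div_le_of_le_mul (hνle x _)
  have hRT : ∀ n x, R n x ≠ ∞ := fun n x => ne_top_of_le_ne_top hM (hRle n x)
  -- the ratio inequality at every pair and every `n`
  have hnull : ∀ (x : ι → ℝ) (r : ℝ), π (closedBall x r) = 0 → ν (closedBall x r) = 0 := fun x r h0 => by
    rw [hν]; exact withDensity_absolutelyContinuous π f h0
  have hRineq : ∀ n x y, R n x * R n y ≤ R n (x ⊓ y) * R n (x ⊔ y) := fun n x y =>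
    div_mul_div_le_of_mul_le (closedBall_mul_le_of_mIsSetTP2 hTP x y (hrpos n).le)
      (pi_closedBall_mul_eq ρ x y (hrpos n).le) (hnull x _) (hnull y _) (measure_ne_top _ _) (measure_ne_top _ _)
  -- the ultrafilter limit
  have hex : ∀ x, ∃ l : ℝ≥0∞, Tendsto (fun n => R n x) (hyperfilter ℕ : Filter ℕ) (𝓝 l) :=
    fun x => exists_tendsto_hyperfilter _
  choose g hg using hex
  have hgle : ∀ x, g x ≤ M := fun x => le_of_tendsto' (hg x) fun n => hRle n x
  have hgT : ∀ x, g x ≠ ∞ := fun x => ne_top_of_le_ne_top hM (hgle x)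
  refine ⟨g, hgle, ?_, fun x y => ?_⟩
  · -- `g = f` a.e.: Besicovitch–Lebesgue differentiation along `r_n = 1/(n+1)`
    have hrn : Tendsto (fun n : ℕ => ((n : ℝ) + 1)⁻¹) atTop (𝓝[>] 0) := by
      refine tendsto_nhdsWithin_iff.2 ⟨?_, Eventually.of_forall fun n => hrpos n⟩
      simpa only [one_div] using tendsto_one_div_add_atTop_nhds_zero_nat (𝕜 := ℝ)
    have hrnd : f =ᵐ[π] ν.rnDeriv π := by
      rw [hν]; exact (Measure.rnDeriv_withDensity π hf).symm
    filter_upwards [Besicovitch.ae_tendsto_rnDeriv ν π, hrnd] with x hx hxf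
    have h1 : Tendsto (fun n => R n x) atTop (𝓝 (f x)) := by
      rw [hxf]; exact hx.comp hrn
    have h2 : Tendsto (fun n => R n x) (hyperfilter ℕ : Filter ℕ) (𝓝 (f x)) :=
      h1.mono_left (hyperfilter_le_cofinite.trans_eq Nat.cofinite_eq_atTop)
    exact tendsto_nhds_unique (hg x) h2
  · -- the inequality passes to the ultrafilter limit (multiplicative and monotone on bounded sequences)
    have hL : Tendsto (fun n => R n x * R n y) (hyperfilter ℕ : Filter ℕ) (𝓝 (g x * g y)) :=
      ENNReal.Tendsto.mul (hg x) (Or.inr (hgT y)) (hg y) (Or.inr (hgT x))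
    have hRt : Tendsto (fun n => R n (x ⊓ y) * R n (x ⊔ y)) (hyperfilter ℕ : Filter ℕ)
        (𝓝 (g (x ⊓ y) * g (x ⊔ y))) :=
      ENNReal.Tendsto.mul (hg _) (Or.inr (hgT _)) (hg _) (Or.inr (hgT _))
    exact le_of_tendsto_of_tendsto' hL hRt fun n => hRineq n x y

/-- **Corollary: a bounded a.e.-pair MTP₂ density defines the SAME law as an everywhere-MTP₂ weight**:
`π·f = π·g` with `g` MTP₂ at every pair — so every theorem of the tree stated for everywhere-MTP₂ weights (e.g.
`mIsSetTP2_withDensity_pi`, Karlin–Rinott's FKG `KarlinRinott1980_thm_2_3_holds`) applies to the law `π·f` through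
`g`, modulo the measurability each of them asks of the weight. [this work] -/
theorem exists_mtp2_weight_withDensity_eq_of_ae (ρ : ι → Measure ℝ) [∀ i, IsFiniteMeasure (ρ i)]
    (f : (ι → ℝ) → ℝ≥0∞) (hf : Measurable f) {M : ℝ≥0∞} (hM : M ≠ ∞) (hfM : ∀ x, f x ≤ M)
    (hMTP : ∀ᵐ p ∂(Measure.pi ρ).prod (Measure.pi ρ), f p.1 * f p.2 ≤ f (p.1 ⊓ p.2) * f (p.1 ⊔ p.2)) :
    ∃ g : (ι → ℝ) → ℝ≥0∞, (∀ x, g x ≤ M) ∧ AEMeasurable g (Measure.pi ρ) ∧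
      (Measure.pi ρ).withDensity g = (Measure.pi ρ).withDensity f ∧
      ∀ x y, g x * g y ≤ g (x ⊓ y) * g (x ⊔ y) := by
  obtain ⟨g, hgM, hgf, hg⟩ := exists_mtp2_version_of_ae ρ f hf hM hfM hMTP
  exact ⟨g, hgM, hf.aemeasurable.congr hgf.symm, withDensity_congr_ae hgf, hg⟩

/-! ### Locally finite reference factors (e.g. Lebesgue measure on `ℝ^ι`) — appended v2 -/

/-- **An everywhere-MTP₂ version of a bounded almost-everywhere-pair MTP₂ density, locally finite reference factors**
(e.g. Lebesgue measure on `ℝ^ι`).  Let `π = ⊗ᵢ ρᵢ` be a product of locally finite measures on `ℝ^ι` (`ι` finite) and `f : ℝ^ι → [0,∞]` measurable, bounded by `M < ∞`, with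
`f(x) f(y) ≤ f(x ∧ y) f(x ∨ y)` for `π ⊗ π`-ALMOST EVERY `(x, y)`.  Then there is `g : ℝ^ι → [0,∞]`, `g ≤ M`,
`g = f` `π`-almost everywhere, with `g(x) g(y) ≤ g(x ∧ y) g(x ∨ y)` for ALL `x, y`.  (`g` = ultrafilter limit of the
ratios `(f·π)(B(x,r_n))/π(B(x,r_n))` over shrinking sup-norm balls; MTP₂ of the ratios at every pair from the a.e.
four functions theorem and the product identity for `π` on boxes; `g = f` a.e. by Besicovitch differentiation.
Measurability of `g` is not asserted beyond `g =ᵐ[π] f`.) [this work] -/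
theorem exists_mtp2_version_of_ae_of_isLocallyFiniteMeasure (ρ : ι → Measure ℝ)
    [∀ i, IsLocallyFiniteMeasure (ρ i)] (f : (ι → ℝ) → ℝ≥0∞)
    (hf : Measurable f) {M : ℝ≥0∞} (hM : M ≠ ∞) (hfM : ∀ x, f x ≤ M)
    (hMTP : ∀ᵐ p ∂(Measure.pi ρ).prod (Measure.pi ρ), f p.1 * f p.2 ≤ f (p.1 ⊓ p.2) * f (p.1 ⊔ p.2)) :
    ∃ g : (ι → ℝ) → ℝ≥0∞, (∀ x, g x ≤ M) ∧ g =ᵐ[Measure.pi ρ] f ∧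
      ∀ x y, g x * g y ≤ g (x ⊓ y) * g (x ⊔ y) := by
  set π := Measure.pi ρ with hπ
  set ν := π.withDensity f with hν
  -- `ν ≤ M • π` is locally finite
  haveI : IsLocallyFiniteMeasure ν := by
    lift M to NNReal using hM
    have hle : ν ≤ M • π := by
      rw [hν, ENNReal.smul_def, ← withDensity_const]
      exact withDensity_mono (ae_of_all _ hfM)
    exact Measure.isLocallyFiniteMeasure_of_le hle
  -- set-TP₂ of `ν` from the a.e. four functions theorem, on balls
  have hTP : mIsSetTP2 ν :=
    Literature.Probability.LatticeModels.Affiliation.mIsSetTP2_withDensity_pi_of_ae ρ f hf hMTP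
  -- the ratios
  set R : ℕ → (ι → ℝ) → ℝ≥0∞ := fun n x =>
    ν (closedBall x ((n : ℝ) + 1)⁻¹) / π (closedBall x ((n : ℝ) + 1)⁻¹) with hR
  have hrpos : ∀ n : ℕ, (0 : ℝ) < ((n : ℝ) + 1)⁻¹ := fun n => by positivity
  have hνle : ∀ (x : ι → ℝ) (r : ℝ), ν (closedBall x r) ≤ M * π (closedBall x r) := fun x r => by
    rw [hν, withDensity_apply _ measurableSet_closedBall]
    calc ∫⁻ y in closedBall x r, f y ∂π ≤ ∫⁻ _ in closedBall x r, M ∂π := lintegral_mono hfM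
      _ = M * π (closedBall x r) := by rw [setLIntegral_const]
  have hRle : ∀ n x, R n x ≤ M := fun n x => by
    simp only [hR]
    exact ENNReal.div_le_of_le_mul (hνle x _)
  have hRT : ∀ n x, R n x ≠ ∞ := fun n x => ne_top_of_le_ne_top hM (hRle n x)
  -- the ratio inequality at every pair and every `n`
  have hnull : ∀ (x : ι → ℝ) (r : ℝ), π (closedBall x r) = 0 → ν (closedBall x r) = 0 := fun x r h0 => by
    rw [hν]; exact withDensity_absolutelyContinuous π f h0
  have hRineq : ∀ n x y, R n x * R n y ≤ R n (x ⊓ y) * R n (x ⊔ y) := fun n x y =>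
    div_mul_div_le_of_mul_le (closedBall_mul_le_of_mIsSetTP2 hTP x y (hrpos n).le)
      (pi_closedBall_mul_eq ρ x y (hrpos n).le) (hnull x _) (hnull y _) measure_closedBall_lt_top.ne
      measure_closedBall_lt_top.ne
  -- the ultrafilter limit
  have hex : ∀ x, ∃ l : ℝ≥0∞, Tendsto (fun n => R n x) (hyperfilter ℕ : Filter ℕ) (𝓝 l) :=
    fun x => exists_tendsto_hyperfilter _
  choose g hg using hex
  have hgle : ∀ x, g x ≤ M := fun x => le_of_tendsto' (hg x) fun n => hRle n x
  have hgT : ∀ x, g x ≠ ∞ := fun x => ne_top_of_le_ne_top hM (hgle x)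
  refine ⟨g, hgle, ?_, fun x y => ?_⟩
  · -- `g = f` a.e.: Besicovitch–Lebesgue differentiation along `r_n = 1/(n+1)`
    have hrn : Tendsto (fun n : ℕ => ((n : ℝ) + 1)⁻¹) atTop (𝓝[>] 0) := by
      refine tendsto_nhdsWithin_iff.2 ⟨?_, Eventually.of_forall fun n => hrpos n⟩
      simpa only [one_div] using tendsto_one_div_add_atTop_nhds_zero_nat (𝕜 := ℝ)
    have hrnd : f =ᵐ[π] ν.rnDeriv π := by
      rw [hν]; exact (Measure.rnDeriv_withDensity π hf).symm
    filter_upwards [Besicovitch.ae_tendsto_rnDeriv ν π, hrnd] with x hx hxf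
    have h1 : Tendsto (fun n => R n x) atTop (𝓝 (f x)) := by
      rw [hxf]; exact hx.comp hrn
    have h2 : Tendsto (fun n => R n x) (hyperfilter ℕ : Filter ℕ) (𝓝 (f x)) :=
      h1.mono_left (hyperfilter_le_cofinite.trans_eq Nat.cofinite_eq_atTop)
    exact tendsto_nhds_unique (hg x) h2
  · -- the inequality passes to the ultrafilter limit (multiplicative and monotone on bounded sequences)
    have hL : Tendsto (fun n => R n x * R n y) (hyperfilter ℕ : Filter ℕ) (𝓝 (g x * g y)) :=
      ENNReal.Tendsto.mul (hg x) (Or.inr (hgT y)) (hg y) (Or.inr (hgT x))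
    have hRt : Tendsto (fun n => R n (x ⊓ y) * R n (x ⊔ y)) (hyperfilter ℕ : Filter ℕ)
        (𝓝 (g (x ⊓ y) * g (x ⊔ y))) :=
      ENNReal.Tendsto.mul (hg _) (Or.inr (hgT _)) (hg _) (Or.inr (hgT _))
    exact le_of_tendsto_of_tendsto' hL hRt fun n => hRineq n x y


/-- **Lebesgue reference measure**: a bounded measurable `f : ℝ^ι → [0,∞]` which is MTP₂ on Lebesgue-almost every pair
admits an everywhere-MTP₂ version (Lebesgue-a.e. equal, same bound). [this work] -/
theorem exists_mtp2_version_of_ae_volume (f : (ι → ℝ) → ℝ≥0∞) (hf : Measurable f) {M : ℝ≥0∞} (hM : M ≠ ∞)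
    (hfM : ∀ x, f x ≤ M)
    (hMTP : ∀ᵐ p ∂(volume : Measure (ι → ℝ)).prod volume, f p.1 * f p.2 ≤ f (p.1 ⊓ p.2) * f (p.1 ⊔ p.2)) :
    ∃ g : (ι → ℝ) → ℝ≥0∞, (∀ x, g x ≤ M) ∧ g =ᵐ[volume] f ∧ ∀ x y, g x * g y ≤ g (x ⊓ y) * g (x ⊔ y) :=
  exists_mtp2_version_of_ae_of_isLocallyFiniteMeasure (fun _ : ι => (volume : Measure ℝ)) f hf hM hfM hMTP

end Summit.CriticalPhenomena.PercolationContinuityZ3.Theorems.SahiAEFourFunctions
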